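import Summits.ResolutionOfSingularities.ResolutionOfSingularities.Theorems.FrobeniusClosingPatchingRelPerfectMonomialRouteKOrder
import Summits.ResolutionOfSingularities.ResolutionOfSingularities.Theorems.FrobeniusClosingPatchingRelPerfectMonomialSumLocalPair
import Literature.AlgebraicGeometry.Resolution.BlowupSequencesAppend
import Literature.AlgebraicGeometry.Resolution.BlowupRestrictOpen
import Literature.AlgebraicGeometry.Resolution.KollarOrderReduction
import Summits.ResolutionOfSingularities.ResolutionOfSingularities.Theorems.FrobeniusClosingPatchingRelPerfectDepthOrderToolkit
import Summits.ResolutionOfSingularities.ResolutionOfSingularities.Theorems.FrobeniusClosingPatchingRelPerfectDepthPhaseCEndTailLP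
import Summits.ResolutionOfSingularities.ResolutionOfSingularities.Theorems.FrobeniusClosingPatchingRelPerfectDepthPhaseCReachNDom
import HarnessLib

/-!
# Crux `PatchingRelPerfect` (stmt-ResolutionOfSingularities-16161), chain W5.2 — F7(β) (β-AX) C-I, (G-A):
# ORDER REDUCTION SUFFICES — the locally monomial game from marked order reduction, by descending induction

[OURS · L1 W5.2 · F7(β) (β-AX) X3 C-I (G-A) (res-L1-w52-plan-1 g12 RULING G12-41 (4); statement = res-L1-w52-idea-1΄s Sketch v19 §4.5
`X3LemmaM.EndOrderReductionSuffices`, bodies UNFOLDED until the defs module `…PhaseCX3Defs` lands)] Fact-free; def-free; NOT statements of the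
manuscript under review (Hironaka 2017); AI-written, weaker than expert review.

* §1 `exists_idealOrder_lt_of_locally_monomialSum` — THE ORDER BOUND: on a Noetherian regular scheme an ideal sheaf which is, near every point of
  its cosupport, a `monomialSum` in a locally-snc letter list has bounded order (local bound = total exponent of one row, read through
  `PolyhedraGame.RouteK.mem_support_monomialSum_marked_iff` on the presentation open and `ChainW52F7BetaRP.weightAt_le_sum_map_snd`;
  global by a finite subcover).  (The tree΄s
  `isClosed_setOf_le_idealOrder` wants integral + excellent, which `LocallyMonomialGame` does not carry.)
* §2 `exists_principalization_of_orderReduction` — THE DESCENDING INDUCTION, for an ARBITRARY «locally END» predicate family `E` (never opened):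
  marked order reduction for every `m ≥ 1` (`EndOrderReduction m`, read for `E`) + an order bound ⇒ a regular-centre tower over `cosupp K` with
  regular top principalising `K` (`CentreSeq.append`; `K·𝒪 = M·K₁` with `M` effective Cartier; at `m = 0`, `K = ⊤`).
* §3 `endOrderReductionSuffices` — (G-A) `X3LemmaM.EndOrderReductionSuffices` with `IsEndNear` / `EndOrderReduction` / `LocallyMonomialGame`
  unfolded: §2 with `E := IsEndNear`, the bound by §1.

## References
* J. Kollár, *Lectures on Resolution of Singularities* (2007), 3.109, (3.111) Step 3. [Kollar2007]
* E. Bierstone, D. Grigoriev, P. Milman, J. Włodarczyk (2011), Def. 3.1.2, §4 Step 2b. [BierstoneGrigorievMilmanWlodarczyk2011]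
-/

-- `Summit.<Summit>.<Sub>.Theorems` with `Sub = Summit` (single-conjunct summit, D-0017)
set_option linter.dupNamespace false

noncomputable section

open CategoryTheory CategoryTheory.Limits AlgebraicGeometry TopologicalSpace IsLocalRing
open Literature.AlgebraicGeometry.Resolution Scheme.IdealSheafData

namespace Summit.ResolutionOfSingularities.ResolutionOfSingularities.Theorems

universe u

namespace X3LocalGame

open DepthTargets

/-! ## §1 The order of a locally monomial ideal is bounded -/

section OrderBound

variable {X : Scheme.{u}}

/-- **LOCAL ORDER BOUND**: if `K|_U = (monomialSum 𝒦)|_U` on an open `U` where the letters of `𝒦` are snc and `L ∈ 𝒦`, then at every point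
of `U` the order of `K` is at most the total exponent of `L` (`ord ≥ m` at a point forces weight `≥ m` for EVERY row, BGMW Def. 3.1.2 read
for monomial sums). [cite: BierstoneGrigorievMilmanWlodarczyk2011, Def. 3.1.2] -/
theorem idealOrder_le_of_monomialSum_on (K : X.IdealSheafData) (U : X.Opens) (Λ : List X.IdealSheafData)
    (hsnc : HasSNC (Λ.map fun F => F.comap U.ι)) (𝒦 : List (List (X.IdealSheafData × ℕ))) (hbd : ∀ L ∈ 𝒦, boundaryOf L = Λ)
    (hK : K.comap U.ι = (monomialSum 𝒦).comap U.ι) {L : List (X.IdealSheafData × ℕ)} (hL : L ∈ 𝒦) (u : (U : Scheme.{u})) :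
    idealOrder K (U.ι u) ≤ ((L.map Prod.snd).sum : ℕ) := by
  classical
  -- read everything on `U`
  set 𝒦U : List (List ((U : Scheme.{u}).IdealSheafData × ℕ)) := 𝒦.map fun A => A.map fun p => (p.1.comap U.ι, p.2) with h𝒦U
  have hKU : K.comap U.ι = monomialSum 𝒦U := by rw [hK, comap_monomialSum_eq_map]
  have hsncU : ∀ A ∈ 𝒦U, HasSNC (boundaryOf A) := by
    intro A hA
    obtain ⟨L', hL', rfl⟩ := List.mem_map.mp hA
    rw [boundaryOf_map_comap, hbd L' hL']
    exact hsnc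
  have hLU : (L.map fun p => (p.1.comap U.ι, p.2)) ∈ 𝒦U := List.mem_map.mpr ⟨L, hL, rfl⟩
  -- the order on `U` is the order on `X`
  rw [← idealOrder_comap_of_isOpenImmersion U.ι K u, hKU]
  -- `ord_u ≥ b + 1` would force `weight_u L ≥ b + 1 > total exponent`
  set b : ℕ := (L.map Prod.snd).sum with hb
  by_contra hlt
  have hle : ((b + 1 : ℕ) : ℕ∞) ≤ idealOrder (monomialSum 𝒦U) u := by
    rw [not_le] at hlt
    exact Order.add_one_le_of_lt (by exact_mod_cast hlt)
  have hmem : u ∈ (⟨monomialSum 𝒦U, [], b + 1⟩ : MarkedIdeal (U : Scheme.{u})).support := hle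
  have hw := (PolyhedraGame.RouteK.mem_support_monomialSum_marked_iff 𝒦U hsncU [] (b + 1) u).mp hmem _ hLU
  have hw' := ChainW52F7BetaRP.weightAt_le_sum_map_snd (L.map fun p => (p.1.comap U.ι, p.2)) u
  have hsum : ((L.map fun p => (p.1.comap U.ι, p.2)).map Prod.snd).sum = b := by
    rw [hb, List.map_map]
    rfl
  omega

/-- **GLOBAL ORDER BOUND** for a locally monomial ideal on a Noetherian scheme: finitely many presentation opens cover the cosupport (the
complement of the cosupport has order `0`). [folklore] -/
theorem exists_idealOrder_le_of_locally_monomialSum [IsNoetherian X] (K : X.IdealSheafData)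
    (hloc : ∀ x ∈ (K.support : Set X), ∃ (U : X.Opens), x ∈ (U : Set X) ∧ ∃ (Λ : List X.IdealSheafData)
      (𝒦 : List (List (X.IdealSheafData × ℕ))), HasSNC (Λ.map fun F => F.comap U.ι) ∧ (∀ L ∈ 𝒦, boundaryOf L = Λ) ∧ 𝒦 ≠ [] ∧
        K.comap U.ι = (monomialSum 𝒦).comap U.ι) :
    ∃ m : ℕ, ∀ x : X, idealOrder K x ≤ (m : ℕ∞) := by
  classical
  -- a local bound at every point
  have hpt : ∀ x : X, ∃ (V : Set X) (b : ℕ), IsOpen V ∧ x ∈ V ∧ ∀ y ∈ V, idealOrder K y ≤ (b : ℕ∞) := by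
    intro x
    by_cases hx : x ∈ (K.support : Set X)
    · obtain ⟨U, hxU, Λ, 𝒦, hsnc, hbd, hne, hK⟩ := hloc x hx
      obtain ⟨L, hL⟩ := List.exists_mem_of_ne_nil 𝒦 hne
      refine ⟨U, (L.map Prod.snd).sum, U.2, hxU, fun y hy => ?_⟩
      obtain ⟨u, rfl⟩ : y ∈ Set.range U.ι.base := by rwa [Scheme.Opens.range_ι]
      exact idealOrder_le_of_monomialSum_on K U Λ hsnc 𝒦 hbd hK hL u
    · refine ⟨(K.support : Set X)ᶜ, 0, K.support.isClosed.isOpen_compl, hx, fun y hy => ?_⟩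
      rw [(DepthTargets.idealOrder_eq_zero_iff_not_mem_support K y).mpr hy]
      exact le_rfl
  choose V b hVo hxV hVb using hpt
  obtain ⟨t, ht⟩ := isCompact_univ.elim_finite_subcover V hVo fun x _ => Set.mem_iUnion.mpr ⟨x, hxV x⟩
  refine ⟨t.sup b, fun x => ?_⟩
  obtain ⟨x₀, hx₀t, hx⟩ : ∃ x₀ ∈ t, x ∈ V x₀ := by
    have h := ht (Set.mem_univ x)
    simp only [Set.mem_iUnion, exists_prop] at h
    exact h
  exact (hVb x₀ x hx).trans (by exact_mod_cast Finset.le_sup hx₀t)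

end OrderBound

/-! ## §2 The descending induction on the maximal order -/

section Induction

/-- An ideal sheaf of order `0` everywhere is the unit ideal. [folklore] -/
theorem eq_top_of_idealOrder_le_zero {X : Scheme.{u}} (K : X.IdealSheafData) (h : ∀ x : X, idealOrder K x ≤ ((0 : ℕ) : ℕ∞)) : K = ⊤ := by
  rw [← Scheme.IdealSheafData.support_eq_bot_iff, ← le_bot_iff]
  intro x hx
  have h0 : idealOrder K x = 0 := nonpos_iff_eq_zero.mp (by exact_mod_cast h x)
  exact absurd hx ((DepthTargets.idealOrder_eq_zero_iff_not_mem_support K x).mp h0)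

variable (E : ∀ ⦃Y : Scheme.{u}⦄, Y.IdealSheafData → List Y.IdealSheafData → Y → Prop)

/-- [OURS · L1 W5.2 · C-I (G-A)] **THE DESCENDING INDUCTION**: marked ORDER REDUCTION for every `m ≥ 1` (the body of
`X3LemmaM.EndOrderReduction m`, for an arbitrary «locally END» predicate `E`) principalises every `E`-locally-END ideal of order `≤ m`
everywhere by a regular-centre tower over its cosupport with regular top (`K·𝒪 = M·K₁`, `M` effective Cartier, `ord K₁ < m`; append; at
`m = 0` the ideal is `⊤`). [cite: Kollar2007, 3.109, (3.111) Step 3] -/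
theorem exists_principalization_of_orderReduction_le
    (hred : ∀ m : ℕ, 1 ≤ m → ∀ (X : Scheme.{u}) [IsNoetherian X], Scheme.IsRegular X →
      ∀ (K : X.IdealSheafData) (𝓛 : List X.IdealSheafData),
        (∀ x ∈ (K.support : Set X), E K 𝓛 x) → (∀ x : X, idealOrder K x ≤ (m : ℕ∞)) →
          ∃ s : CentreSeq X, s.AllRegular ∧ s.CentresOver (⟨K, [], m⟩ : MarkedIdeal X).support ∧ Scheme.IsRegular s.top ∧
            ∃ (_ : IsNoetherian s.top) (M K₁ : s.top.IdealSheafData) (𝓛₁ : List s.top.IdealSheafData),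
              K.comap s.comp = M * K₁ ∧ IsEffectiveCartier M ∧
              (∀ x : s.top, idealOrder K₁ x < (m : ℕ∞)) ∧
              (∀ x ∈ (K₁.support : Set s.top), E K₁ 𝓛₁ x) ∧
              (K₁.support : Set s.top) ⊆ s.comp ⁻¹' (K.support : Set X)) :
    ∀ (m : ℕ) (X : Scheme.{u}) [IsNoetherian X], Scheme.IsRegular X →
      ∀ (K : X.IdealSheafData) (𝓛 : List X.IdealSheafData),
        (∀ x ∈ (K.support : Set X), E K 𝓛 x) → (∀ x : X, idealOrder K x ≤ (m : ℕ∞)) →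
          ∃ s : CentreSeq X, s.AllRegular ∧ s.CentresOver (K.support : Set X) ∧
            Scheme.IsRegular s.top ∧ IsLocallyPrincipal (K.comap s.comp) := by
  intro m
  induction m with
  | zero =>
    intro X _ hX K 𝓛 _ hord
    have hK : K = ⊤ := eq_top_of_idealOrder_le_zero K hord
    refine ⟨CentreSeq.nil X, trivial, trivial, hX, ?_⟩
    rw [hK, Scheme.IdealSheafData.comap_top]
    exact isLocallyPrincipal_top _
  | succ m ih =>
    intro X _ hX K 𝓛 hE hord
    -- one round of order reduction
    obtain ⟨s₁, hreg₁, hover₁, htop₁, hN₁, M, K₁, 𝓛₁, hKM, hM, hord₁, hE₁, hsupp₁⟩ :=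
      hred (m + 1) (Nat.succ_le_succ (Nat.zero_le m)) X hX K 𝓛 hE hord
    haveI := hN₁
    -- the rest by induction (`ord K₁ ≤ m`)
    have hord₁' : ∀ x : s₁.top, idealOrder K₁ x ≤ (m : ℕ∞) := fun x => by
      have h := hord₁ x
      rw [Nat.cast_succ] at h
      exact Order.le_of_lt_add_one h
    obtain ⟨s₂, hreg₂, hover₂, htop₂, hlp₂⟩ := ih s₁.top htop₁ K₁ 𝓛₁ hE₁ hord₁'
    refine ⟨s₁.append s₂, (CentreSeq.allRegular_append_iff s₁ s₂).mpr ⟨hreg₁, hreg₂⟩,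
      (CentreSeq.centresOver_append_iff s₁ s₂ _).mpr ⟨?_, CentreSeq.CentresOver.mono s₂ hsupp₁ hover₂⟩, ?_, ?_⟩
    · -- the first tower΄s centres lie over `Sing(K, m+1) ⊆ cosupp K`
      refine CentreSeq.CentresOver.mono s₁ (fun x hx => ?_) hover₁
      have hx' : ((m + 1 : ℕ) : ℕ∞) ≤ idealOrder K x := hx
      by_contra hxs
      rw [(DepthTargets.idealOrder_eq_zero_iff_not_mem_support K x).mpr hxs] at hx'
      exact absurd hx' (by exact_mod_cast Nat.succ_ne_zero m ∘ fun h => (Nat.le_zero.mp h))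
    · rw [CentreSeq.top_append]
      exact htop₂
    · rw [CentreSeq.comp_append, ChainW52F7BetaR.isLocallyPrincipal_comap_eqToHom_comp_iff, Scheme.IdealSheafData.comap_comp, hKM,
        comap_mul]
      exact (hM.isLocallyPrincipal.comap s₂.comp).mul hlp₂

/-- [OURS · L1 W5.2 · C-I (G-A)] **ORDER REDUCTION SUFFICES, abstract form**: for any «locally END» predicate `E` whose ideals have BOUNDED
order, marked order reduction for every `m ≥ 1` gives the locally monomial game. [cite: Kollar2007, (3.111) Step 3] -/
theorem exists_principalization_of_orderReduction
    (hbound : ∀ (X : Scheme.{u}) [IsNoetherian X], Scheme.IsRegular X → ∀ (K : X.IdealSheafData) (𝓛 : List X.IdealSheafData),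
      (∀ x ∈ (K.support : Set X), E K 𝓛 x) → ∃ m : ℕ, ∀ x : X, idealOrder K x ≤ (m : ℕ∞))
    (hred : ∀ m : ℕ, 1 ≤ m → ∀ (X : Scheme.{u}) [IsNoetherian X], Scheme.IsRegular X →
      ∀ (K : X.IdealSheafData) (𝓛 : List X.IdealSheafData),
        (∀ x ∈ (K.support : Set X), E K 𝓛 x) → (∀ x : X, idealOrder K x ≤ (m : ℕ∞)) →
          ∃ s : CentreSeq X, s.AllRegular ∧ s.CentresOver (⟨K, [], m⟩ : MarkedIdeal X).support ∧ Scheme.IsRegular s.top ∧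
            ∃ (_ : IsNoetherian s.top) (M K₁ : s.top.IdealSheafData) (𝓛₁ : List s.top.IdealSheafData),
              K.comap s.comp = M * K₁ ∧ IsEffectiveCartier M ∧
              (∀ x : s.top, idealOrder K₁ x < (m : ℕ∞)) ∧
              (∀ x ∈ (K₁.support : Set s.top), E K₁ 𝓛₁ x) ∧
              (K₁.support : Set s.top) ⊆ s.comp ⁻¹' (K.support : Set X))
    (X : Scheme.{u}) [IsNoetherian X] (hX : Scheme.IsRegular X) (K : X.IdealSheafData) (𝓛 : List X.IdealSheafData)
    (hE : ∀ x ∈ (K.support : Set X), E K 𝓛 x) :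
    ∃ s : CentreSeq X, s.AllRegular ∧ s.CentresOver (K.support : Set X) ∧ Scheme.IsRegular s.top ∧
      IsLocallyPrincipal (K.comap s.comp) := by
  obtain ⟨m, hm⟩ := hbound X hX K 𝓛 hE
  exact exists_principalization_of_orderReduction_le E hred m X hX K 𝓛 hE hm

end Induction

/-! ## §3 (G-A) `EndOrderReductionSuffices`, unfolded -/

/-- [OURS · L1 W5.2 · C-I (G-A)] **`X3LemmaM.EndOrderReductionSuffices`** (res-L1-w52-idea-1 Sketch v19 §4.5), with `IsEndNear`,
`EndOrderReduction` and `LocallyMonomialGame` UNFOLDED: marked order reduction for locally-END ideals, for every `m ≥ 1`, implies the locally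
monomial game (regular-centre principalisation over the cosupport, regular top, of every ideal that is locally END w.r.t. snc sub-families of
one global letter list). [cite: Kollar2007, (3.111) Step 3] [cite: BierstoneGrigorievMilmanWlodarczyk2011, §4 Step 2b] -/
theorem endOrderReductionSuffices
    (hred : ∀ m : ℕ, 1 ≤ m → ∀ (X : Scheme.{u}) [IsNoetherian X], Scheme.IsRegular X →
      ∀ (K : X.IdealSheafData) (𝓛 : List X.IdealSheafData), 1 ≤ m →
        (∀ x ∈ (K.support : Set X), ∃ Λ : List X.IdealSheafData, (∀ F ∈ Λ, F ∈ 𝓛) ∧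
          ∃ U : X.Opens, x ∈ (U : Set X) ∧ HasSNC (Λ.map fun F => F.comap U.ι) ∧
            ∃ 𝒦 : List (List (X.IdealSheafData × ℕ)), (∀ L ∈ 𝒦, boundaryOf L = Λ) ∧ 𝒦 ≠ [] ∧
              K.comap U.ι = (DepthTargets.monomialSum 𝒦).comap U.ι) →
        (∀ x : X, idealOrder K x ≤ (m : ℕ∞)) →
          ∃ s : CentreSeq X, s.AllRegular ∧ s.CentresOver (⟨K, [], m⟩ : MarkedIdeal X).support ∧ Scheme.IsRegular s.top ∧
            ∃ (_ : IsNoetherian s.top) (M K₁ : s.top.IdealSheafData) (𝓛₁ : List s.top.IdealSheafData),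
              K.comap s.comp = M * K₁ ∧ IsEffectiveCartier M ∧
              (∀ x : s.top, idealOrder K₁ x < (m : ℕ∞)) ∧
              (∀ x ∈ (K₁.support : Set s.top), ∃ Λ : List s.top.IdealSheafData, (∀ F ∈ Λ, F ∈ 𝓛₁) ∧
                ∃ U : s.top.Opens, x ∈ (U : Set s.top) ∧ HasSNC (Λ.map fun F => F.comap U.ι) ∧
                  ∃ 𝒦 : List (List (s.top.IdealSheafData × ℕ)), (∀ L ∈ 𝒦, boundaryOf L = Λ) ∧ 𝒦 ≠ [] ∧
                    K₁.comap U.ι = (DepthTargets.monomialSum 𝒦).comap U.ι) ∧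
              (K₁.support : Set s.top) ⊆ s.comp ⁻¹' (K.support : Set X)) :
    ∀ (X : Scheme.{u}) [IsNoetherian X], Scheme.IsRegular X →
      ∀ (K : X.IdealSheafData) (𝓛 : List X.IdealSheafData),
        (∀ x ∈ (K.support : Set X), ∃ Λ : List X.IdealSheafData, (∀ F ∈ Λ, F ∈ 𝓛) ∧
          ∃ U : X.Opens, x ∈ (U : Set X) ∧ HasSNC (Λ.map fun F => F.comap U.ι) ∧
            ∃ 𝒦 : List (List (X.IdealSheafData × ℕ)), (∀ L ∈ 𝒦, boundaryOf L = Λ) ∧ 𝒦 ≠ [] ∧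
              K.comap U.ι = (DepthTargets.monomialSum 𝒦).comap U.ι) →
          ∃ s : CentreSeq X, s.AllRegular ∧ s.CentresOver (K.support : Set X) ∧
            Scheme.IsRegular s.top ∧ IsLocallyPrincipal (K.comap s.comp) := by
  intro X _ hX K 𝓛 hE
  refine exists_principalization_of_orderReduction
    (fun ⦃Y : Scheme.{u}⦄ (K : Y.IdealSheafData) (𝓛 : List Y.IdealSheafData) (x : Y) =>
      ∃ Λ : List Y.IdealSheafData, (∀ F ∈ Λ, F ∈ 𝓛) ∧
        ∃ U : Y.Opens, x ∈ (U : Set Y) ∧ HasSNC (Λ.map fun F : Y.IdealSheafData => F.comap U.ι) ∧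
          ∃ 𝒦 : List (List (Y.IdealSheafData × ℕ)), (∀ L ∈ 𝒦, boundaryOf L = Λ) ∧ 𝒦 ≠ [] ∧
            K.comap U.ι = (DepthTargets.monomialSum 𝒦).comap U.ι)
    (fun Y _ _ K 𝓛 hE => exists_idealOrder_le_of_locally_monomialSum K fun x hx => ?_)
    (fun m hm Y _ hY K 𝓛 hE hord => hred m hm Y hY K 𝓛 hm hE hord) X hX K 𝓛 hE
  obtain ⟨Λ, -, U, hxU, hsnc, 𝒦, hbd, hne, hK⟩ := hE x hx
  exact ⟨U, hxU, Λ, 𝒦, hsnc, hbd, hne, hK⟩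

end X3LocalGame

end Summit.ResolutionOfSingularities.ResolutionOfSingularities.Theorems

end
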